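import Literature.NumberTheory.DiophantineGeometry.GenEllDePoint
import HarnessLib

/-!
# Junction adapters for the `D_e`-point in the `(r, s, t)`-currency of the `t_c`-family
# ([GenEll] Thm. 2.1 proof p. 12, GENELLTWO-P1ROUTE §2 (A))

S. Mochizuki, *Arithmetic elliptic curves in general position*, Math. J. Okayama Univ. **52** (2010),
proof of Thm. 2.1, p. 12 («every point of `U_X(ℚ̄)^{≤d}` lifts to `U_Y(ℚ̄)^{≤d′}`»)
[cite: MochizukiGenEll2010, Thm 2.1 proof p.12].  Proof-only companion of `GenEllDePoint.lean`
(the `D_e`-point `P.dePoint e = (F(r), x)`, `r^e = x(1−x)`): the four small facts the `GenEllTwo`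
assembly (stmt-ABC-19679) needs to feed the `t_c`-height lemma
`Superelliptic.exists_belyi_tFunC_hZht_dePoint` and the `(r, s, t)`-junctions of the W5 family
(`s = 1 − 2x'`, `t·(r·s) = s + q·r^{k+2}`) BY NAME:

* `deRoot_pow_dePoint` — `r^e = x'(1 − x')` in `F(r)` (`x'` the coordinate of `P.dePoint e`);
* `deRoot_ne_zero` — `r ≠ 0` over a point of `U`;
* `one_sub_two_mul_dePoint_x_ne_zero_iff` — the pole condition `1 − 2x' ≠ 0 ↔ 1 − 2x ≠ 0`;
* `exists_tC_junction` — over a point of `U` off the pole fibre the junction data `(s, t)` exist: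
  `s = 1 − 2x' ≠ 0`, `t·(r·s) = s + q·r^{k+2}` (`t = t_q(x', r)`).

Classical; theorems only; nothing here bears on [IUTchIII] Cor. 3.12.
-/

noncomputable section

namespace Literature.NumberTheory.DiophantineGeometry.GenEll

namespace NFPoint

variable (P : NFPoint) (e : ℕ)

/-- **`r^e = x'(1 − x')` on the `D_e`-point itself** (`x'` = the coordinate of `P.dePoint e`): the curve
relation in the presenting field `F(r)` — the `hcurve`/`hr` binder of the `t_c`-height and junction lemmas.
[cite: MochizukiGenEll2010, Thm 2.1 proof p.12] -/
theorem deRoot_pow_dePoint (he : 0 < e) :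
    P.deRoot e ^ e = (P.dePoint e).x * (1 - (P.dePoint e).x) := by
  rw [P.deRoot_pow e he, dePoint_x, map_mul, map_sub, map_one]

/-- **`r ≠ 0` over a point of `U`** (`r^e = x(1−x) ≠ 0` for `x ≠ 0, 1`).
[cite: MochizukiGenEll2010, Thm 2.1 proof p.12] -/
theorem deRoot_ne_zero (hP : P.InU) (he : 0 < e) : P.deRoot e ≠ 0 := by
  intro h
  have h1 := P.deRoot_pow e he
  rw [h, zero_pow (Nat.pos_iff_ne_zero.mp he), eq_comm,
    map_eq_zero_iff _ (algebraMap P.F (P.deField e)).injective] at h1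
  exact mul_ne_zero hP.1 (sub_ne_zero.mpr (Ne.symm hP.2)) h1

/-- **The pole condition transfers**: `1 − 2x' ≠ 0` on `P.dePoint e` iff `1 − 2x ≠ 0` on `P` (the pole
fibre `x = 1/2` of the functions `t_c = ((1−2x) + c·r^{k+2})/(r(1−2x))`).
[cite: MochizukiGenEll2010, Thm 2.1 proof p.12] -/
theorem one_sub_two_mul_dePoint_x_ne_zero_iff :
    1 - 2 * (P.dePoint e).x ≠ 0 ↔ 1 - 2 * P.x ≠ 0 := by
  have h : 1 - 2 * (P.dePoint e).x = algebraMap P.F (P.deField e) (1 - 2 * P.x) := by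
    rw [dePoint_x, map_sub, map_one, map_mul, map_ofNat]
  rw [h, ne_eq, map_eq_zero_iff _ (algebraMap P.F (P.deField e)).injective]

/-- **The `(s, t)`-junction data exist** over every point of `U` off the pole fibre: with `e = 2k+1`,
`r = P.deRoot e`, `s := 1 − 2x' ≠ 0` and `t := (s + q·r^{k+2})/(r·s)` one has `t·(r·s) = s + q·r^{k+2}`
— exactly the binders `(s t : (P.dePoint (2k+1)).F)`, `s = 1 − 2·(P.dePoint (2k+1)).x`, `s ≠ 0`,
`t·(P.deRoot (2k+1)·s) = s + q·P.deRoot (2k+1)^{k+2}` of the `t_c`-height lemma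
`Superelliptic.exists_belyi_tFunC_hZht_dePoint`, so that the value `t = t_q(x', r)` of the family member
with parameter `q` at the `D_e`-point is available to the closer by `obtain`.
[cite: MochizukiGenEll2010, Thm 2.1 proof p.12] -/
theorem exists_tC_junction (k : ℕ) (q : ℚ) (hP : P.InU) (hs : 1 - 2 * P.x ≠ 0) :
    ∃ s t : (P.dePoint (2 * k + 1)).F, s = 1 - 2 * (P.dePoint (2 * k + 1)).x ∧ s ≠ 0 ∧
      t * (P.deRoot (2 * k + 1) * s) =
        s + (q : (P.dePoint (2 * k + 1)).F) * P.deRoot (2 * k + 1) ^ (k + 2) := by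
  have hs' : 1 - 2 * (P.dePoint (2 * k + 1)).x ≠ 0 :=
    (P.one_sub_two_mul_dePoint_x_ne_zero_iff (2 * k + 1)).mpr hs
  have hr : P.deRoot (2 * k + 1) ≠ 0 := P.deRoot_ne_zero (2 * k + 1) hP (by omega)
  refine ⟨1 - 2 * (P.dePoint (2 * k + 1)).x,
    (1 - 2 * (P.dePoint (2 * k + 1)).x + (q : (P.dePoint (2 * k + 1)).F) * P.deRoot (2 * k + 1) ^ (k + 2)) /
      (P.deRoot (2 * k + 1) * (1 - 2 * (P.dePoint (2 * k + 1)).x)), rfl, hs', ?_⟩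
  rw [div_mul_cancel₀ _ (mul_ne_zero hr hs')]

/-- **The `t`-value is determined** by the junction equation (`r·s ≠ 0`): `t = (s + q·r^{k+2})/(r·s)`.
[cite: MochizukiGenEll2010, Thm 2.1 proof p.12] -/
theorem tC_eq_of_junction (k : ℕ) (q : ℚ) (hP : P.InU) {s t : (P.dePoint (2 * k + 1)).F}
    (hs : s = 1 - 2 * (P.dePoint (2 * k + 1)).x) (hs0 : s ≠ 0)
    (ht : t * (P.deRoot (2 * k + 1) * s) =
      s + (q : (P.dePoint (2 * k + 1)).F) * P.deRoot (2 * k + 1) ^ (k + 2)) :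
    t = (s + (q : (P.dePoint (2 * k + 1)).F) * P.deRoot (2 * k + 1) ^ (k + 2)) /
      (P.deRoot (2 * k + 1) * s) := by
  have hr : P.deRoot (2 * k + 1) ≠ 0 := P.deRoot_ne_zero (2 * k + 1) hP (by omega)
  subst hs
  rw [eq_div_iff (mul_ne_zero hr hs0), ht]

/-- **The junction equation for the EXPLICIT `t`-term** (so that the closer can define the auxiliary
point `Z P := (P.dePoint e).imageAt (ρ(t))` by a hypothesis-free lambda and discharge the binder
`t·(r·s) = s + q·r^{k+2}` of `Superelliptic.exists_belyi_tFunC_hZht_dePoint` afterwards): with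
`x'` the coordinate of `P.dePoint (2k+1)`, `r = P.deRoot (2k+1)` and
`t := ((1 − 2x') + q·r^{k+2}) / (r·(1 − 2x'))`, one has `t·(r·(1 − 2x')) = (1 − 2x') + q·r^{k+2}` over a
point of `U` off the pole fibre. [cite: MochizukiGenEll2010, Thm 2.1 proof p.12] -/
theorem explicit_tC_junction (k : ℕ) (q : ℚ) (hP : P.InU) (hs : 1 - 2 * P.x ≠ 0) :
    ((1 - 2 * (P.dePoint (2 * k + 1)).x +
        (q : (P.dePoint (2 * k + 1)).F) * P.deRoot (2 * k + 1) ^ (k + 2)) /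
      (P.deRoot (2 * k + 1) * (1 - 2 * (P.dePoint (2 * k + 1)).x))) *
      (P.deRoot (2 * k + 1) * (1 - 2 * (P.dePoint (2 * k + 1)).x)) =
    (1 - 2 * (P.dePoint (2 * k + 1)).x) +
      (q : (P.dePoint (2 * k + 1)).F) * P.deRoot (2 * k + 1) ^ (k + 2) := by
  have hs' : 1 - 2 * (P.dePoint (2 * k + 1)).x ≠ 0 :=
    (P.one_sub_two_mul_dePoint_x_ne_zero_iff (2 * k + 1)).mpr hs
  have hr : P.deRoot (2 * k + 1) ≠ 0 := P.deRoot_ne_zero (2 * k + 1) hP (by omega)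
  rw [div_mul_cancel₀ _ (mul_ne_zero hr hs')]

/-- `r·s ≠ 0` over a point of `U` off the pole fibre (`s = 1 − 2x'`): the non-degeneracy binder `hrs`
of the W5 junction / defect theorems at the `D_e`-point. [cite: MochizukiGenEll2010, Thm 2.1 proof p.12] -/
theorem deRoot_mul_one_sub_two_mul_ne_zero (he : 0 < e) (hP : P.InU) (hs : 1 - 2 * P.x ≠ 0) :
    P.deRoot e * (1 - 2 * (P.dePoint e).x) ≠ 0 :=
  mul_ne_zero (P.deRoot_ne_zero e hP he) ((P.one_sub_two_mul_dePoint_x_ne_zero_iff e).mpr hs)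

/-- The hyperelliptic normal form at the `D_e`-point: with `s := 1 − 2x'` one has `s² = 1 − 4·r^e`
(`r^e = x'(1−x')`) — the `hcurve : s² = 1 − 4r^(2k+1)` binder of the W5 (r,s)-currency.
[cite: MochizukiGenEll2010, Thm 2.1 proof p.12] -/
theorem one_sub_two_mul_sq_dePoint (he : 0 < e) :
    (1 - 2 * (P.dePoint e).x) ^ 2 = 1 - 4 * P.deRoot e ^ e := by
  rw [P.deRoot_pow_dePoint e he]
  ring

end NFPoint

end Literature.NumberTheory.DiophantineGeometry.GenEll

end
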